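import Mathlib
import Summits.ResolutionOfSingularities.ResolutionOfSingularities.Theses.PAlteration
import Summits.ResolutionOfSingularities.ResolutionOfSingularities.Theorems.PicoverLocalModel.Negative.PowerDichotomy
import Summits.ResolutionOfSingularities.ResolutionOfSingularities.Theorems.PAlterationPicoverLocalModelFiniteDim
import Summits.ResolutionOfSingularities.ResolutionOfSingularities.Theorems.PAlterationPicoverLocalModelPullbackIntegral
import Summits.ResolutionOfSingularities.ResolutionOfSingularities.Theorems.PAlterationPicoverLocalModelModificationTransfer
import Literature.AlgebraicGeometry.Resolution.KummerNormalForm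
import Literature.AlgebraicGeometry.Resolution.LogRegularAtlas
import Literature.AlgebraicGeometry.Resolution.QuasiProjectiveResolution

/-!
# Crux `PicoverLocalModel` (stmt-ResolutionOfSingularities-0557), line `SketchIdeator3`
# (giraud-cossart-normal-form) — the reduction of the crux to its residue and its endgame

The line "normalise the radicand, not the cover" (Giraud 1983, Cossart 1987, Posva 2024 App. A)
reduces the crux — every purely inseparable hypersurface `T^p = a` over a regular affine base
`Spec R` has a weak resolution — to two statements about the REGULAR base and one printed
theorem:

* the RESIDUE `GiraudCossartNormalForm`: for `R` a regular finitely generated `k`-domain of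
  dimension `≤ n` and `a ∈ R ∖ R^p`, some proper birational regular modification `π : W → Spec R`
  with an snc boundary `E` puts `π^* a` in (intrinsic, boundary-adapted) Giraud normal form
  (`Literature.AlgebraicGeometry.Resolution.InGiraudNormalForm`) at every point of `W` — Giraud's
  conjecture (1983, p. 115), known for `n ≤ 2` (Giraud 1983, Thm. 2.4) and `n = 3` (Cossart
  1987), OPEN for `n ≥ 4` (`Literature.Barriers.ResolutionOfSingularities.DimensionFourFrontier`);
* the ENDGAME: the pulled-back model `X_a ×_{Spec R} W` of a radicand in Giraud normal form along
  an snc boundary of a regular variety has a weak resolution — split as (algebra) its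
  normalisation carries a log-regular Zariski fs atlas (`LogRegularAtlas`; Giraud 1983 Prop. 1.5,
  Kato 1994 Thm. 11.6) and (resolution) the named fact
  `Kato1994_logRegular_hasResolution_general` (Kato 1994 (10.4), Nizioł 2006 Thm. 5.8).

This file records the reduction as sorry-free theorems whose hypotheses are exactly these
statements, written out as `∀`-propositions (no new named facts are introduced here; the two
research/printed inputs are the registered stubs `stub_cossartNormalForm`, `stub_endgameAtlas`,
`stub_logResolution` of the line's skeleton `Cruxes/PicoverLocalModel/Lines/SketchIdeator3.lean`):

* `picoverLocalModel_of_normalForm_of_endgame` — RESIDUE + ENDGAME ⇒ crux BY NAME;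
* `hasResolution_of_logRegularAtlas_model` — ATLAS + Kato ⇒ ENDGAME (for any scheme with such a model);
* `picoverLocalModel_of_normalForm_of_atlas` — RESIDUE + ATLAS + Kato ⇒ crux BY NAME.

The transfer steps are the landed stubs `FiniteDim.stub_finiteDim` (p106226),
`PullbackIntegral.stub_pullbackIntegral` (p109439), `ModificationTransfer.stub_modificationTransfer`
(p109722) and the `p`-th-power dichotomy `Negative.picoverLocalModel_iff_nonpower` (p91981).
-/

noncomputable section

-- single-problem summit: the doubled namespace component `ResolutionOfSingularities` is the tree layout
set_option linter.dupNamespace false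

open CategoryTheory CategoryTheory.Limits AlgebraicGeometry TopologicalSpace Polynomial
open Literature.AlgebraicGeometry.Resolution

namespace Summit.ResolutionOfSingularities.ResolutionOfSingularities.Theorems.PicoverLocalModel.GiraudReduction

open Summit.ResolutionOfSingularities.ResolutionOfSingularities.Theorems.PicoverLocalModel

/-! ## The three statements of the line, as propositions -/

/-- The model `X_a → Spec R` is dominant (it is surjective: `R ⊆ R[T]/(T^p - a)` is an injective
integral extension of a domain). [folklore] -/
theorem isDominant_model (p : ℕ) [Fact p.Prime] (R : Type) [CommRing R] [IsDomain R] (a : R) :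
    IsDominant (Spec.map (CommRingCat.ofHom (algebraMap R (AdjoinRoot ((X : R[X]) ^ p - C a))))) := by
  haveI := PullbackIntegral.surjective_model p R a
  exact ⟨(Spec.map (CommRingCat.ofHom
    (algebraMap R (AdjoinRoot ((X : R[X]) ^ p - C a))))).surjective.denseRange⟩

/-- **RESIDUE + ENDGAME ⇒ crux.** If (residue) for every regular finitely generated `k`-domain
`R` of finite dimension `≤ n` and every `a ∈ R ∖ R^p` some proper birational regular integral
modification `W → Spec R` with an snc boundary `E` puts `a` in Giraud normal form along `E` at
every point, and (endgame) the pulled-back model `X_a ×_{Spec R} W` of any radicand in Giraud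
normal form along an snc boundary of a regular integral separated finite-type `k`-scheme `W` has a
weak resolution as soon as it is integral, then `PicoverLocalModel` holds: WLOG `a ∉ R^p`
(`Negative.picoverLocalModel_iff_nonpower`); `dim R < ∞` (`FiniteDim.stub_finiteDim`); the
pulled-back model is integral (`PullbackIntegral.stub_pullbackIntegral`: `R` is normal and `π`
birational) and its resolution transfers down the proper birational base change
(`ModificationTransfer.stub_modificationTransfer`). [folklore] -/
theorem picoverLocalModel_of_normalForm_of_endgame : ∀ (hNF : ∀ (n : ℕ) (p : ℕ), p.Prime → ∀ (k : Type) [Field k] [CharP k p] (R : Type) [CommRing R] [IsDomain R] [Algebra k R], Algebra.FiniteType k R → IsRegularRing R → ringKrullDim R ≤ n → ∀ a : R, (∀ b : R, b ^ p ≠ a) → ∃ (W : Scheme.{0}) (π : W ⟶ Spec (.of R)) (E : List W.IdealSheafData), IsProper π ∧ IsBirational π ∧ IsIntegral W ∧ Scheme.IsRegular W ∧ HasSNC E ∧ InGiraudNormalForm p W π a E) (hEnd : ∀ (p : ℕ) [Fact p.Prime] (k : Type) [Field k] [CharP k p] (W : Scheme.{0}) (f : W ⟶ Spec (.of k)) [IsSeparated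 f] [LocallyOfFiniteType f] [QuasiCompact f] [IsIntegral W], Scheme.IsRegular W → ∀ (R : Type) [CommRing R] (π : W ⟶ Spec (.of R)) (a : R) (E : List W.IdealSheafData), HasSNC E → InGiraudNormalForm p W π a E → IsIntegral (pullback (Spec.map (CommRingCat.ofHom (algebraMap R (AdjoinRoot ((X : R[X]) ^ p - C a))))) π) → Scheme.HasResolution (pullback (Spec.map (CommRingCat.ofHom (algebraMap R (AdjoinRoot ((X : R[X]) ^ p - C a))))) π)), Summit.ResolutionOfSingularities.ResolutionOfSingularities.Theses.PAlteration.PicoverLocalModel := by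
  intro hNF hEnd
  rw [Negative.picoverLocalModel_iff_nonpower]
  intro p hp k _ _ R _ _ _ hft hreg a ha
  haveI : Fact p.Prime := ⟨hp⟩
  haveI : CharP R p := charP_of_injective_algebraMap (algebraMap k R).injective p
  haveI : IsIntegrallyClosed R := Negative.isIntegrallyClosed_of_isRegularRing R
  -- dimension grading
  obtain ⟨n, hn⟩ := FiniteDim.stub_finiteDim k R hft
  -- the residue: Giraud normal form on a regular modification `W` of the base
  obtain ⟨W, π, E, hπ, hbir, hW, hWreg, hE, hGNF⟩ := hNF n p hp k R hft hreg hn a ha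
  -- `W` is separated of finite type over `k`
  let g : Spec (.of R) ⟶ Spec (.of k) := Spec.map (CommRingCat.ofHom (algebraMap k R))
  haveI : Algebra.FiniteType k R := hft
  haveI : LocallyOfFiniteType g := Negative.locallyOfFiniteType_Spec_of_finiteType k R
  let f : W ⟶ Spec (.of k) := π ≫ g
  haveI : IsSeparated f := inferInstance
  haveI : LocallyOfFiniteType f := inferInstance
  haveI : QuasiCompact f := inferInstance
  -- the model `X_a → Spec R`
  set μ : Spec (.of (AdjoinRoot ((X : R[X]) ^ p - C a))) ⟶ Spec (.of R) :=
    Spec.map (CommRingCat.ofHom (algebraMap R (AdjoinRoot ((X : R[X]) ^ p - C a)))) with hμ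
  haveI : IsDomain (AdjoinRoot ((X : R[X]) ^ p - C a)) :=
    Negative.isDomain_adjoinRoot_of_not_pow p R ha
  haveI : IsIntegral (Spec (.of (AdjoinRoot ((X : R[X]) ^ p - C a)))) := inferInstance
  haveI : IsDominant μ := isDominant_model p R a
  -- the pulled-back model is integral
  have hint : IsIntegral (pullback μ π) :=
    PullbackIntegral.stub_pullbackIntegral p R a ha W π hbir
  -- the endgame
  have hres : Scheme.HasResolution (pullback μ π) := hEnd p k W f hWreg R π a E hE hGNF hint
  -- transfer down to `X_a`
  exact ModificationTransfer.stub_modificationTransfer _ _ W μ π hbir hint hres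

/-- **ATLAS + Kato ⇒ ENDGAME** for one pulled-back model: if some proper birational `ν : Y' → Y`
has `Y'` carrying a log-regular Zariski fs atlas, then — granted the named fact
`Kato1994_logRegular_hasResolution_general` (Kato 1994 (10.4); Nizioł 2006 Thm. 5.8: a scheme
with a log-regular atlas has a resolution) — `Y` has a weak resolution: resolve `Y'` and come
down `ν` (`Scheme.HasResolution.of_isBirational`). [cite: Kato1994, (10.4)] -/
theorem hasResolution_of_logRegularAtlas_model : ∀ (hKato : Kato1994_logRegular_hasResolution_general.{0}) {Y : Scheme.{0}} (h : ∃ (Y' : Scheme.{0}) (ν : Y' ⟶ Y), IsProper ν ∧ IsBirational ν ∧ Nonempty (LogRegularAtlas Y')), Scheme.HasResolution Y := by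
  intro hKato Y h
  obtain ⟨Y', ν, hν, hνbir, ⟨atlas⟩⟩ := h
  haveI := hν
  exact Scheme.HasResolution.of_isBirational ν hνbir (hKato Y' ⟨atlas⟩)

/-- **RESIDUE + ATLAS + Kato ⇒ crux.** The full conditional closure of the line: if (residue)
Giraud–Cossart normal form holds in every dimension, (atlas) the pulled-back model of a radicand
in Giraud normal form along an snc boundary of a regular variety has a proper birational model
with a log-regular Zariski fs atlas (its normalisation: regular over the wound/transversal
points, toric over the Kummer points — Giraud 1983 Prop. 1.5, Kato 1994 Thm. 11.6), and Kato's
theorem `Kato1994_logRegular_hasResolution_general` holds, then `PicoverLocalModel` holds.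
[cite: Giraud1983, Prop. 1.5] -/
theorem picoverLocalModel_of_normalForm_of_atlas : ∀ (hKato : Kato1994_logRegular_hasResolution_general.{0}) (hNF : ∀ (n : ℕ) (p : ℕ), p.Prime → ∀ (k : Type) [Field k] [CharP k p] (R : Type) [CommRing R] [IsDomain R] [Algebra k R], Algebra.FiniteType k R → IsRegularRing R → ringKrullDim R ≤ n → ∀ a : R, (∀ b : R, b ^ p ≠ a) → ∃ (W : Scheme.{0}) (π : W ⟶ Spec (.of R)) (E : List W.IdealSheafData), IsProper π ∧ IsBirational π ∧ IsIntegral W ∧ Scheme.IsRegular W ∧ HasSNC E ∧ InGiraudNormalForm p W π a E) (hAtlas : ∀ (p : ℕ) [Fact p.Prime] (k : Type) [Field k] [CharP k p] (W : Scheme.{0}) (f : W ⟶ Spec (.of k)) [IsSeparated f] [LocallyOfFiniteType f] [QuasiCompact f] [IsIntegral W], Scheme.IsRegular W → ∀ (R : Type) [CommRing R] (π : W ⟶ Spec (.of R)) (a : R) (E : List W.IdealSheafData), HasSNC E → InGiraudNormalForm p W π a E → IsIntegral (pullback (Spec.map (CommRingCat.ofHom (algebraMap R (AdjoinRoot ((X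 : R[X]) ^ p - C a))))) π) → ∃ (Y' : Scheme.{0}) (ν : Y' ⟶ pullback (Spec.map (CommRingCat.ofHom (algebraMap R (AdjoinRoot ((X : R[X]) ^ p - C a))))) π), IsProper ν ∧ IsBirational ν ∧ Nonempty (LogRegularAtlas Y')), Summit.ResolutionOfSingularities.ResolutionOfSingularities.Theses.PAlteration.PicoverLocalModel := by
  intro hKato hNF hAtlas
  exact picoverLocalModel_of_normalForm_of_endgame hNF
    (fun p _ k _ _ W f _ _ _ _ hW R _ π a E hE hGNF hint =>
      hasResolution_of_logRegularAtlas_model hKato (hAtlas p k W f hW R π a E hE hGNF hint))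

end Summit.ResolutionOfSingularities.ResolutionOfSingularities.Theorems.PicoverLocalModel.GiraudReduction

end
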